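import Summits.Ventures.PackingBounds.Energy.TenPointCkSevenUnique
import Summits.Ventures.PackingBounds.Configurations.PetersenCodeUnique
import HarnessLib

/-!
# Ten points on `S³`, potential `(1+⟪x,y⟫)^7`: the ground state is the Petersen code (unique up to isometry)

Framing: lottery ticket; floor = certified bounds/negative ranges. Venture `PackingBounds`, cell
`pub-packcert`, energy family E3PT (pub-packcert-energy gen 13; n = 4 kernel route = KERNEL-D6 data route + `threePointF 4`).

Assembly of `TenPointCkSeven.ck7_ten_points_rigid` (a minimiser is a ten-point `{1/6, -2/3}`-code of `ℝ⁴`) with the clique-frame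
uniqueness theorem `Config.PetersenCodeUnique.isometric`: any two minimisers are isometric, and every minimiser has the Petersen
code's distance distribution (`PetersenCodeUnique.energy_eq`).
-/

noncomputable section

open Finset
open scoped RealInnerProductSpace

namespace Summit.Ventures.PackingBounds.Energy.TenPointCkSeven

open Summit.Ventures.PackingBounds.Config

/-- **`(1+t)^7`-energy of ten points on `S³`, uniqueness:** any two minimisers (`Σ_{x≠y} (1+⟪x,y⟫)^7 = 4118035/23328`) are related
by a linear isometry of `ℝ⁴` (both are the Petersen code). -/
theorem minimisers_isometric (C C' : Finset (EuclideanSpace ℝ (Fin 4)))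
    (hC : ∀ x ∈ C, ‖x‖ = 1) (h10 : C.card = 10)
    (hmin : ∑ x ∈ C, ∑ y ∈ C.erase x, (1 + inner ℝ x y) ^ 7 = ((4118035 : ℝ)/23328))
    (hC' : ∀ x ∈ C', ‖x‖ = 1) (h10' : C'.card = 10)
    (hmin' : ∑ x ∈ C', ∑ y ∈ C'.erase x, (1 + inner ℝ x y) ^ 7 = ((4118035 : ℝ)/23328)) :
    ∃ Ψ : EuclideanSpace ℝ (Fin 4) ≃ₗᵢ[ℝ] EuclideanSpace ℝ (Fin 4), C' = C.image Ψ :=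
  PetersenCodeUnique.isometric hC h10 (ck7_ten_points_rigid C hC h10 hmin) hC' h10' (ck7_ten_points_rigid C' hC' h10' hmin')

/-- **The ground state has the Petersen code's distance distribution:** for every pair potential `a`, a minimiser of the
`(1+t)^7`-energy has `Σ_{x≠y} a(⟪x,y⟫) = 10·(3·a(-2/3) + 6·a(1/6))`. -/
theorem ground_state_energy (C : Finset (EuclideanSpace ℝ (Fin 4))) (hC : ∀ x ∈ C, ‖x‖ = 1) (h10 : C.card = 10)
    (hmin : ∑ x ∈ C, ∑ y ∈ C.erase x, (1 + inner ℝ x y) ^ 7 = ((4118035 : ℝ)/23328)) (a : ℝ → ℝ) :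
    ∑ x ∈ C, ∑ y ∈ C.erase x, a (inner ℝ x y) = (10 : ℝ) * (3 * a (-2 / 3) + 6 * a (1 / 6)) :=
  PetersenCodeUnique.energy_eq hC h10 (ck7_ten_points_rigid C hC h10 hmin) a

end Summit.Ventures.PackingBounds.Energy.TenPointCkSeven
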